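import Literature.Computability.QuantumComplexity.ForrelationMemSpec
import Literature.Computability.Complexity.HashBricks
import HarnessLib

/-!
# Signed 2-fold Forrelation is in `PromiseBQP`, I: the phase machine of the Hadamard-test family

Topic `Literature/Computability/QuantumComplexity`. First machine file of the white-box version of
Aaronson–Ambainis, SIAM J. Comput. 47 (2018), §3.2 Prop. 6 at `k = 2`: the promise problem
"`Φ(f,g) ≥ 3/5` versus `Φ(f,g) ≤ -3/5`" on codes of explicit instances `(n, 2, C₀, C₁)` is in
`PromiseBQP`. The family is an instance of the tree's phase-query families (`PhaseQuery*.lean`,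
instantiated for plain `k`-fold Forrelation in `ForrelationMem*.lean`): the same layout
(`cW = 8` spare query wires, `cL = 0`, so that every field lemma of `ForrelationMemFields.lean`
applies verbatim) with a NEW mode-multiplexed function `FnS`:

* mode `W` answers `1^{W_d + 1}` active wires: `W_d = min(n, #R + 1) + [n odd]` DATA wires
  (`wdS`, model `wdNat`; `#R` the distinct read wires; `W_d` is even and `≥ n` whenever
  `n ≤ #R + 1`, which every instance of the promise satisfies) plus ONE control wire;
* mode `K` answers `1⁴`: three phase layers;
* mode `P`, on `⟨x, ⟨u, 1ʲ0^{L-j}⟩⟩`, answers the gadget predicates of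
  `SignedForrelationGadget.lean` read off the register `u` (`GphaseS`, model `phaseBitS`):
  layer 1 `c ∧ (C₀(u) ⊕ C₁(0…0))`, layer 2 `C₁(u) ⊕ q(u)`, layer 3 `c ∧ q(u)`, nothing beyond, where
  `c = u[W_d]` is the control wire and `q(u) = ⟨u[0,t), u[t,2t)⟩ mod 2`, `t = W_d / 2`, is the
  inner product of the two halves of the data wires (`HashBricks.andParityFn`); the circuits are
  evaluated by the white-box evaluator of `ForrelationMemEval.lean` (`evalGatesF`, `wireValF`);
* mode `Z` is the zero test `GzF` of `ForrelationMemEval.lean`.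

Then `FnS ∈ FP`, a machine (`RevClean.exists_outputsWithin_pow_of_mem_FP`), the parameters `paramsS`
and the specification `specS : Spec paramsS`, exactly as in `ForrelationMemSpec.lean`.

## References

* S. Aaronson, A. Ambainis, *Forrelation*, SIAM J. Comput. 47 (2018), §3.2 Prop. 6 and §6 (p. 26)
  [AaronsonAmbainis2018].
* S. Arora, B. Barak, *Computational Complexity: A Modern Approach*, CUP 2009, §1.3, Thm. 6.18
  [AroraBarak2009].
-/

noncomputable section

namespace Literature.Computability.QuantumComplexity

open _root_.Computability Polynomial Complexity Complexity.Brick Plumb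

namespace SgnForrMem

open PhaseQuery ForrMem

/-! ### The number of data wires -/

/-- `#R` read off an input `x = ⟨bin n, ⟨bin k, circuits⟩⟩` (model). [folklore] -/
def lenR (x : List Bool) : ℕ := (dedupVals (occAll (sndF (sndF x)))).length

/-- **The number of data wires** (model): `W_d = min(n, #R + 1) + [n odd]`. [cite: AaronsonAmbainis2018, §6 (p. 26)] -/
def wdNat (x : List Bool) : ℕ :=
  min (bitsToNat (fstF x)) (lenR x + 1) + if Even (bitsToNat (fstF x)) then 0 else 1

/-- The ruler `1^{#R + 1}`. [folklore] -/
def rulerS : List Bool → List Bool := fun x => (lenItemsF ∘ dedupF ∘ occAllF ∘ sndF ∘ sndF) x ++ [true]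

/-- `rulerS ∈ FP`. [folklore] -/
theorem rulerS_mem_FP : rulerS ∈ FP :=
  append_mem_FP (comp_mem_FP lenItemsF_mem_FP (comp_mem_FP dedupF_mem_FP (comp_mem_FP occAllF_mem_FP
    (comp_mem_FP sndF_mem_FP sndF_mem_FP)))) (const_mem_FP _)

/-- Value of `rulerS`. [folklore] -/
theorem rulerS_apply (x : List Bool) : rulerS x = ones (lenR x + 1) := by
  rw [rulerS]
  simp only [Function.comp_apply, occAllF_apply, dedupF_apply, decNil_encList, lenItemsF_apply, lenR]
  simp [ones, List.replicate_succ']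

/-- `1^{min(n, #R + 1)}`. [folklore] -/
def capS : List Bool → List Bool := binToUnaryFn ∘ fanoutFn rulerS fstF

/-- `capS ∈ FP`. [folklore] -/
theorem capS_mem_FP : capS ∈ FP := comp_mem_FP binToUnaryFn_mem_FP (fanoutFn_mem_FP rulerS_mem_FP fstF_mem_FP)

/-- Value of `capS`. [folklore] -/
theorem capS_apply (x : List Bool) : capS x = ones (min (bitsToNat (fstF x)) (lenR x + 1)) := by
  rw [capS, Function.comp_apply, fanoutFn_apply, binToUnaryFn_boolPair, rulerS_apply]
  simp [ones]

/-- **`1^{W_d}`**: the cap, one more if `n` is odd. [cite: AaronsonAmbainis2018, §6 (p. 26)] -/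
def wdS : List Bool → List Bool := iteFn (parityFn ∘ fstF) capS fun x => capS x ++ [true]

/-- `wdS ∈ FP`. [folklore] -/
theorem wdS_mem_FP : wdS ∈ FP :=
  iteFn_mem_FP (comp_mem_FP parityFn_mem_FP fstF_mem_FP) capS_mem_FP (append_mem_FP capS_mem_FP (const_mem_FP _))

/-- Value of `wdS`. [folklore] -/
theorem wdS_apply (x : List Bool) : wdS x = ones (wdNat x) := by
  have hc : (parityFn ∘ fstF) x = [decide (Even (bitsToNat (fstF x)))] := rfl
  rw [wdS, iteFn_apply hc, wdNat]
  by_cases h : Even (bitsToNat (fstF x))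
  · rw [decide_eq_true h, if_pos rfl, if_pos h, capS_apply]; simp
  · rw [decide_eq_false h, if_neg Bool.false_ne_true, if_neg h, capS_apply]; simp [ones, List.replicate_succ']

/-- **The answer of mode `W`**: `1^{W_d + 1}` (data wires and the control wire). [cite: AaronsonAmbainis2018, §3.2 Prop. 6] -/
def GwS : List Bool → List Bool := fun x => wdS x ++ [true]

/-- `GwS ∈ FP`. [folklore] -/
theorem GwS_mem_FP : GwS ∈ FP := append_mem_FP wdS_mem_FP (const_mem_FP _)

/-- Value of `GwS`. [folklore] -/
theorem GwS_apply (x : List Bool) : GwS x = ones (wdNat x + 1) := by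
  rw [GwS, wdS_apply]; simp [ones, List.replicate_succ']

/-- **The answer of mode `K`**: `1⁴` (three phase layers, four Hadamard layers). [cite: AaronsonAmbainis2018, §3.2 Prop. 6] -/
def GkS : List Bool → List Bool := fun _ => ones 4

/-- `GkS ∈ FP`. [folklore] -/
theorem GkS_mem_FP : GkS ∈ FP := const_mem_FP _

/-! ### The bricks of the phase function -/

section Phase

/-- On the record `⟨x, ⟨u, J⟩⟩`: `1^{W_d}`. [folklore] -/
def swdF : List Bool → List Bool := wdS ∘ pxf
/-- … the control bit `u[W_d]`, one-bit. [folklore] -/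
def sctlF : List Bool → List Bool := isSetF (bitAtFn ∘ fanoutFn swdF puf)
/-- … `1ᵗ`, `t = W_d / 2`. [folklore] -/
def shalfF : List Bool → List Bool := halfFn ∘ swdF
/-- … the first half `u[0, t)` of the data wires. [folklore] -/
def su1F : List Bool → List Bool := takeFn ∘ fanoutFn shalfF puf
/-- … the second half `u[t, 2t)` of the data wires. [folklore] -/
def su2F : List Bool → List Bool := takeFn ∘ fanoutFn shalfF (dropFn ∘ fanoutFn shalfF puf)
/-- … the bent bit `q(u) = ⟨u[0,t), u[t,2t)⟩ mod 2`, one-bit. [folklore] -/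
def sqF : List Bool → List Bool := HashBricks.andParityFn ∘ fanoutFn su1F su2F
/-- … the code of circuit `i` (item `i` of the circuit list). [folklore] -/
def scF (i : ℕ) : List Bool → List Bool := HashBricks.nthItemFn ∘ fanoutFn (fun _ => ones i) pCLf
/-- … the gate values of circuit `i` on the register returned by `v`. [folklore] -/
def sVF (i : ℕ) (v : List Bool → List Bool) : List Bool → List Bool := evalGatesF ∘ fanoutFn (fanoutFn pRf v) (fstF ∘ scF i)
/-- … the output bit of circuit `i` on the register returned by `v`, one-bit. [folklore] -/
def soutF (i : ℕ) (v : List Bool → List Bool) : List Bool → List Bool :=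
  wireValF ∘ fanoutFn (fanoutFn pRf (fanoutFn v (sVF i v))) (sndF ∘ scF i)
/-- … bit `i` of the layer register `J`, one-bit. [folklore] -/
def sjbitF (i : ℕ) : List Bool → List Bool := isSetF (bitAtFn ∘ fanoutFn (fun _ => ones i) pJf)
/-- … the layer test `j = i` (`i ≥ 1`): bit `i - 1` of `J` set, bit `i` clear. [folklore] -/
def slayF (i : ℕ) : List Bool → List Bool := andFn (sjbitF (i - 1)) (notFn (sjbitF i))

/-- **The phase bit**: layer 1 `c ∧ (C₀(u) ⊕ C₁(0))`, layer 2 `C₁(u) ⊕ q(u)`, layer 3 `c ∧ q(u)`.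
[cite: AaronsonAmbainis2018, §3.2 Prop. 6] -/
def sbitF : List Bool → List Bool :=
  orFn (andFn (slayF 1) (andFn sctlF (HashBricks.xorFn (soutF 0 puf) (soutF 1 fun _ => []))))
    (orFn (andFn (slayF 2) (HashBricks.xorFn (soutF 1 puf) sqF)) (andFn (slayF 3) (andFn sctlF sqF)))

/-- **The phase function of the Hadamard-test family**: `[]` (phase `−1`) iff the phase bit is set.
[cite: AaronsonAmbainis2018, §3.2 Prop. 6] -/
def GphaseS : List Bool → List Bool := iteFn sbitF (fun _ => []) fun _ => [false]

/-- The small bricks are polynomial time. [folklore] -/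
theorem sbricks_mem_FP : swdF ∈ FP ∧ sctlF ∈ FP ∧ shalfF ∈ FP ∧ su1F ∈ FP ∧ su2F ∈ FP ∧ sqF ∈ FP := by
  have hu : puf ∈ FP := comp_mem_FP fstF_mem_FP sndF_mem_FP
  have hw : swdF ∈ FP := comp_mem_FP wdS_mem_FP fstF_mem_FP
  have hc : sctlF ∈ FP := isSetF_mem_FP (comp_mem_FP bitAtFn_mem_FP (fanoutFn_mem_FP hw hu))
  have hh : shalfF ∈ FP := comp_mem_FP halfFn_mem_FP hw
  have h1 : su1F ∈ FP := comp_mem_FP takeFn_mem_FP (fanoutFn_mem_FP hh hu)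
  have h2 : su2F ∈ FP := comp_mem_FP takeFn_mem_FP (fanoutFn_mem_FP hh (comp_mem_FP dropFn_mem_FP (fanoutFn_mem_FP hh hu)))
  exact ⟨hw, hc, hh, h1, h2, comp_mem_FP HashBricks.andParityFn_mem_FP (fanoutFn_mem_FP h1 h2)⟩

/-- The circuit bricks are polynomial time. [folklore] -/
theorem soutF_mem_FP (i : ℕ) {v : List Bool → List Bool} (hv : v ∈ FP) : soutF i v ∈ FP := by
  obtain ⟨hR, -, -, -, -⟩ := phase_parts_mem_FP
  have hCL : pCLf ∈ FP := comp_mem_FP sndF_mem_FP (comp_mem_FP sndF_mem_FP fstF_mem_FP)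
  have hc : scF i ∈ FP := comp_mem_FP HashBricks.nthItemFn_mem_FP (fanoutFn_mem_FP (const_mem_FP _) hCL)
  have hV : sVF i v ∈ FP := comp_mem_FP evalGatesF_mem_FP (fanoutFn_mem_FP (fanoutFn_mem_FP hR hv) (comp_mem_FP fstF_mem_FP hc))
  exact comp_mem_FP wireValF_mem_FP (fanoutFn_mem_FP (fanoutFn_mem_FP hR (fanoutFn_mem_FP hv hV)) (comp_mem_FP sndF_mem_FP hc))

/-- The layer tests are polynomial time. [folklore] -/
theorem slayF_mem_FP (i : ℕ) : slayF i ∈ FP := by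
  have hb : ∀ i, sjbitF i ∈ FP := fun i =>
    isSetF_mem_FP (comp_mem_FP bitAtFn_mem_FP (fanoutFn_mem_FP (const_mem_FP _) (comp_mem_FP sndF_mem_FP sndF_mem_FP)))
  exact andFn_mem_FP (hb _) (notFn_mem_FP (hb _))

/-- `GphaseS ∈ FP`. [cite: AroraBarak2009, §1.3] -/
theorem GphaseS_mem_FP : GphaseS ∈ FP := by
  obtain ⟨-, hc, -, -, -, hq⟩ := sbricks_mem_FP
  have hu : puf ∈ FP := comp_mem_FP fstF_mem_FP sndF_mem_FP
  have hbit : sbitF ∈ FP :=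
    orFn_mem_FP (andFn_mem_FP (slayF_mem_FP 1) (andFn_mem_FP hc (HashBricks.xorFn_mem_FP (soutF_mem_FP 0 hu) (soutF_mem_FP 1 (const_mem_FP _)))))
      (orFn_mem_FP (andFn_mem_FP (slayF_mem_FP 2) (HashBricks.xorFn_mem_FP (soutF_mem_FP 1 hu) hq))
        (andFn_mem_FP (slayF_mem_FP 3) (andFn_mem_FP hc hq)))
  exact iteFn_mem_FP hbit (const_mem_FP _) (const_mem_FP _)

/-! ### The models and the value of the phase function -/

/-- **The bent bit** (model): the `𝔽₂` inner product of `u[0,t)` and `u[t,2t)`. [folklore] -/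
def qM (t : ℕ) (u : List Bool) : Bool :=
  decide (Odd (((u.take t).zipWith (· && ·) ((u.drop t).take t)).count true))

/-- **The output bit of circuit `i` on register `u`** (model, through the white-box evaluator). [cite: AroraBarak2009, Thm. 6.18 (proof)] -/
def cbitM (x u : List Bool) (i : ℕ) : Bool :=
  let CL := sndF (sndF x)
  let Rl := dedupVals (occAll CL)
  let ci := fstF (sndF^[i] CL)
  wireBit Rl u (evalGatesM Rl u (decNil (fstF ci))) (sndF ci)

/-- **The phase bit of layer `j` on register `u`** (model). [cite: AaronsonAmbainis2018, §3.2 Prop. 6] -/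
def phaseBitS (x u : List Bool) (j : ℕ) : Bool :=
  (decide (j = 1) && (u.getD (wdNat x) false && xor (cbitM x u 0) (cbitM x [] 1))) ||
    ((decide (j = 2) && xor (cbitM x u 1) (qM (wdNat x / 2) u)) ||
      (decide (j = 3) && (u.getD (wdNat x) false && qM (wdNat x / 2) u)))

/-- A bit of the layer word `1ʲ 0^{L-j}` (`j ≤ L`), at any position. [folklore] -/
theorem getD_junary' (L j r : ℕ) (hj : j ≤ L) : (junary L j).getD r false = decide (r < j) := by
  rcases Nat.lt_or_ge r L with hr | hr
  · exact getD_junary L j r hj hr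
  · rw [List.getD_eq_default _ _ (by simp [junary]; omega), eq_comm, decide_eq_false_iff_not]; omega

variable (x u : List Bool) {L j : ℕ} (hj : j ≤ L)

/-- The record. [folklore] -/
abbrev rec (L j : ℕ) : List Bool := boolPair x (boolPair u (junary L j))

/-- The projections of the record. [folklore] -/
theorem rec_proj : pxf (rec x u L j) = x ∧ puf (rec x u L j) = u ∧ pJf (rec x u L j) = junary L j ∧
    pCLf (rec x u L j) = sndF (sndF x) ∧ pRf (rec x u L j) = encList (dedupVals (occAll (sndF (sndF x)))) := by
  refine ⟨by simp [pxf], by simp [puf], by simp [pJf], by simp [pCLf, pxf], ?_⟩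
  rw [pRf, Function.comp_apply, Function.comp_apply, show pCLf (rec x u L j) = sndF (sndF x) by simp [pCLf, pxf], occAllF_apply,
    dedupF_apply, decNil_encList]

/-- `swdF` returns `1^{W_d}`. [folklore] -/
theorem swdF_rec : swdF (rec x u L j) = ones (wdNat x) := by
  rw [swdF, Function.comp_apply, (rec_proj x u).1, wdS_apply]

/-- `sctlF` returns the control bit `u[W_d]`. [folklore] -/
theorem sctlF_rec : sctlF (rec x u L j) = [u.getD (wdNat x) false] := by
  rw [sctlF, ← headD_drop]
  refine isSetF_take_one _ _ _ ?_
  rw [Function.comp_apply, fanoutFn_apply, swdF_rec, (rec_proj x u).2.1, bitAtFn_boolPair]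
  simp [ones]

/-- `shalfF` returns `1ᵗ`. [folklore] -/
theorem shalfF_rec : shalfF (rec x u L j) = ones (wdNat x / 2) := by
  rw [shalfF, Function.comp_apply, swdF_rec]; simp [halfFn, ones]

/-- `sqF` returns the bent bit. [folklore] -/
theorem sqF_rec : sqF (rec x u L j) = [qM (wdNat x / 2) u] := by
  have e1 : su1F (rec x u L j) = u.take (wdNat x / 2) := by
    rw [su1F, Function.comp_apply, fanoutFn_apply, shalfF_rec, (rec_proj x u).2.1, takeFn_boolPair]; simp [ones]
  have e2 : su2F (rec x u L j) = (u.drop (wdNat x / 2)).take (wdNat x / 2) := by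
    rw [su2F, Function.comp_apply, fanoutFn_apply, shalfF_rec, Function.comp_apply, fanoutFn_apply, shalfF_rec, (rec_proj x u).2.1,
      dropFn_boolPair, takeFn_boolPair]; simp [ones]
  rw [sqF, Function.comp_apply, fanoutFn_apply, e1, e2, HashBricks.andParityFn_boolPair, qM]

/-- `scF i` returns the code of circuit `i`. [folklore] -/
theorem scF_rec (i : ℕ) : scF i (rec x u L j) = fstF (sndF^[i] (sndF (sndF x))) := by
  rw [scF, Function.comp_apply, fanoutFn_apply, (rec_proj x u).2.2.2.1, HashBricks.nthItemFn_boolPair]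
  simp [ones]

/-- `soutF i v` returns the output bit of circuit `i` on the register `v`. [cite: AroraBarak2009, Thm. 6.18 (proof)] -/
theorem soutF_rec (i : ℕ) (v : List Bool → List Bool) : soutF i v (rec x u L j) = [cbitM x (v (rec x u L j)) i] := by
  have eV : sVF i v (rec x u L j) = evalGatesM (dedupVals (occAll (sndF (sndF x)))) (v (rec x u L j))
      (decNil (fstF (fstF (sndF^[i] (sndF (sndF x)))))) := by
    rw [sVF, Function.comp_apply, fanoutFn_apply, fanoutFn_apply, (rec_proj x u).2.2.2.2, Function.comp_apply, scF_rec,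
      evalGatesF_apply, decNil_encList]
  rw [soutF, Function.comp_apply, fanoutFn_apply, fanoutFn_apply, fanoutFn_apply, (rec_proj x u).2.2.2.2, eV, Function.comp_apply,
    scF_rec, wireValF_apply, decNil_encList]
  rfl

include hj in
/-- `sjbitF i` returns `[i < j]`. [folklore] -/
theorem sjbitF_rec (i : ℕ) : sjbitF i (rec x u L j) = [decide (i < j)] := by
  rw [sjbitF, ← getD_junary' L j i hj, ← headD_drop]
  refine isSetF_take_one _ _ _ ?_
  rw [Function.comp_apply, fanoutFn_apply, (rec_proj x u).2.2.1, bitAtFn_boolPair]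
  simp [ones]

include hj in
/-- `slayF i` returns `[j = i]` (`1 ≤ i`). [folklore] -/
theorem slayF_rec {i : ℕ} (hi : 1 ≤ i) : slayF i (rec x u L j) = [decide (j = i)] := by
  rw [slayF, andFn_apply (sjbitF_rec x u hj (i - 1)) (notFn_apply (sjbitF_rec x u hj i))]
  congr 1
  by_cases h : j = i
  · subst h; simp; omega
  · rw [decide_eq_false h]
    by_cases h1 : i - 1 < j
    · have h2 : i < j := by omega
      simp [h2]
    · simp [h1]

include hj in
/-- **Value of the phase function** on `⟨x, ⟨u, 1ʲ 0^{L-j}⟩⟩` (`j ≤ L`). [cite: AaronsonAmbainis2018, §3.2 Prop. 6] -/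
theorem GphaseS_apply : GphaseS (rec x u L j) = if phaseBitS x u j then [] else [false] := by
  have eu := (rec_proj x u (L := L) (j := j)).2.1
  have ea : soutF 0 puf (rec x u L j) = [cbitM x u 0] := by rw [soutF_rec, eu]
  have eb : soutF 1 puf (rec x u L j) = [cbitM x u 1] := by rw [soutF_rec, eu]
  have eb0 : soutF 1 (fun _ => []) (rec x u L j) = [cbitM x [] 1] := soutF_rec x u 1 _
  have ebit : sbitF (rec x u L j) = [phaseBitS x u j] := by
    rw [sbitF, phaseBitS]
    exact orFn_apply (andFn_apply (slayF_rec x u hj le_rfl) (andFn_apply (sctlF_rec x u) (HashBricks.xorFn_apply ea eb0)))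
      (orFn_apply (andFn_apply (slayF_rec x u hj (by norm_num)) (HashBricks.xorFn_apply eb (sqF_rec x u)))
        (andFn_apply (slayF_rec x u hj (by norm_num)) (andFn_apply (sctlF_rec x u) (sqF_rec x u))))
  rw [GphaseS, iteFn_apply ebit]

end Phase

/-! ### The function of the phase machine, the parameters, the specification -/

/-- **The function of the phase machine** (modes `W`, `K`, `P`, `Z` on the fields of the data word).
[cite: AaronsonAmbainis2018, §3.2 Prop. 6 and §6 (p. 26)] -/
def FnS : List Bool → List Bool :=
  dispatchF (GwS ∘ xF) (GkS ∘ xF) (GphaseS ∘ fanoutFn xF (fanoutFn qcF jF)) ZmodeF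

/-- **`FnS ∈ FP`.** [cite: AroraBarak2009, §1.3] -/
theorem FnS_mem_FP : FnS ∈ FP :=
  dispatchF_mem_FP (comp_mem_FP GwS_mem_FP xF_mem_FP) (comp_mem_FP GkS_mem_FP xF_mem_FP)
    (comp_mem_FP GphaseS_mem_FP (fanoutFn_mem_FP xF_mem_FP (fanoutFn_mem_FP qcF_mem_FP jF_mem_FP)))
    (comp_mem_FP GzF_mem_FP (fanoutFn_mem_FP q0F_mem_FP (fanoutFn_mem_FP q1F_mem_FP q2F_mem_FP)))

/-- A machine computing `FnS` in time `(n+2)^e`. [cite: AroraBarak2009, §1.3] -/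
theorem exists_machineS : ∃ (e : ℕ) (M : Turing.TM2ComputableAux Bool Bool),
    ∀ w : List Bool, M.OutputsWithin w (FnS w) (RevSim.Tn e w.length) :=
  RevClean.exists_outputsWithin_pow_of_mem_FP FnS_mem_FP

/-- **The parameters of the Hadamard-test phase-query family**: `8` spare query wires, no spare layer,
the function `FnS` and a machine for it. [cite: AaronsonAmbainis2018, §3.2 Prop. 6] -/
def paramsS : Params where
  cW := 8
  cL := 0
  Fn := FnS
  e := Classical.choose exists_machineS
  M := Classical.choose (Classical.choose_spec exists_machineS)
  hM := Classical.choose_spec (Classical.choose_spec exists_machineS)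

/-- The constants of `paramsS`. [folklore] -/
theorem paramsS_consts : paramsS.cW = 8 ∧ paramsS.cL = 0 := ⟨rfl, rfl⟩

/-- `Ly paramsS N = N`, `Wq paramsS N = N + 8`. [folklore] -/
theorem Ly_paramsS (N : ℕ) : Ly paramsS N = N ∧ Wq paramsS N = N + 8 := ⟨rfl, rfl⟩

/-- The phase predicate: input, register content, layer. [cite: AaronsonAmbainis2018, §3.2 Prop. 6] -/
def PfS (x u : List Bool) (j : ℕ) : Bool := decide (GphaseS (boolPair x (boolPair u (junary x.length j))) = [])

/-- **The four equations of `FnS` on data words.** [folklore] -/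
theorem FnS_wd (x : List Bool) (q : ℕ → List Bool) (hq : ∀ c, (q c).length = Wq paramsS x.length) (jv cv : List Bool)
    (hjv : jv.length = Ly paramsS x.length) (hcv : cv.length = 2) :
    FnS (wd x q jv cv [false, false]) = GwS x ∧ FnS (wd x q jv cv [true, false]) = GkS x ∧
    FnS (wd x q jv cv [true, true]) = GzF (boolPair (q 0) (boolPair (q 1) (q 2))) ∧
    ∀ c, c < 3 → cv = ccode c → FnS (wd x q jv cv [false, true]) = GphaseS (boolPair x (boolPair (q c) jv)) := by
  obtain ⟨e1, e2, e3, e4⟩ := dispatchF_wd paramsS x q jv hq hjv paramsS_consts (GwS ∘ xF) (GkS ∘ xF)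
    (GphaseS ∘ fanoutFn xF (fanoutFn qcF jF)) ZmodeF cv hcv
  refine ⟨?_, ?_, ?_, fun c hc hcc => ?_⟩
  · rw [FnS, e1, Function.comp_apply, xF_wd]
  · rw [FnS, e2, Function.comp_apply, xF_wd]
  · obtain ⟨f0, f1, f2, -⟩ := qF_wd paramsS x q jv cv [true, true] hq paramsS_consts
    rw [FnS, e4, ZmodeF, Function.comp_apply, fanoutFn_apply, fanoutFn_apply, f0, f1, f2]
  · subst hcc
    rw [FnS, e3, Function.comp_apply, fanoutFn_apply, fanoutFn_apply, xF_wd, qcF_wd paramsS x q jv hq hjv paramsS_consts hc,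
      jF_wd paramsS x q jv (ccode c) [false, true] hq hjv paramsS_consts]

/-- **The specification of the Hadamard-test phase machine.** [cite: AaronsonAmbainis2018, §3.2 Prop. 6] -/
def specS : Spec paramsS where
  Wv x := (GwS x).length
  Kv x := (GkS x).length
  Pf := PfS
  hW x := by
    show (FnS (wd x _ _ _ _)).length = _
    rw [(FnS_wd x (fun _ => zeros (Wq paramsS x.length)) (fun _ => by simp [zeros]) (zeros (Ly paramsS x.length)) (zeros 2)
      (by simp [zeros]) (by simp [zeros])).1]
  hK x := by
    show (FnS (wd x _ _ _ _)).length = _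
    rw [(FnS_wd x (fun _ => zeros (Wq paramsS x.length)) (fun _ => by simp [zeros]) (zeros (Ly paramsS x.length)) (zeros 2)
      (by simp [zeros]) (by simp [zeros])).2.1]
  hP x q hq j hj1 hjL c hc := by
    show FnS (wd x _ _ _ _) = [] ↔ _
    rw [(FnS_wd x q hq (junary (Ly paramsS x.length) j) (ccode c) (by simp [junary]; omega) (by simp [ccode])).2.2.2 c hc rfl, PfS,
      decide_eq_true_iff, (Ly_paramsS x.length).1]
  hZ x q hq := by
    show FnS (wd x _ _ _ _) = [] ↔ _
    rw [(FnS_wd x q hq (zeros (Ly paramsS x.length)) (zeros 2) (by simp [zeros]) (by simp [zeros])).2.2.1, GzF_eq_nil_iff,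
      hq 0, hq 1, hq 2]
    constructor
    · rintro ⟨h0, h1, h2⟩ c hc
      interval_cases c <;> assumption
    · intro h; exact ⟨h 0 (by norm_num), h 1 (by norm_num), h 2 (by norm_num)⟩

/-- `Kv = 4` on every input, `Wv x = W_d + 1`. [folklore] -/
theorem Kv_Wv (x : List Bool) : specS.Kv x = 4 ∧ specS.Wv x = wdNat x + 1 := by
  refine ⟨by simp [specS, GkS, ones], ?_⟩
  show (GwS x).length = _
  rw [GwS_apply]; simp [ones]

end SgnForrMem

end Literature.Computability.QuantumComplexity
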